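import Summits.BirchSwinnertonDyer.Uniform.UI.O2Binder
import Literature.NumberTheory.EllipticCurves.SteinWuthrich2013.NonsplitMultCanonicalHolds
import HarnessLib

/-!
# Uniform/UI/O2 — END-TO-END head: `TateSigmaIrrationalAtThree` + published binders ⟹ `BSD(E,3)`
# on the non-split lever locus of pocket O2, as ONE theorem

HONEST FRAMING (cell `bsd-uniform`, seat `ui-o2`, gen 4): THEOREMS ONLY; CONDITIONAL on the open
conjecture `TateSigmaIrrationalAtThree` (C4, `Uniform/UI/O2.lean`) and on the PUBLISHED named facts in
the binders (nothing asserted, nothing discharged except where a tree THEOREM exists); proves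
nothing about BSD unconditionally, books nothing, moves no census mark; pocket O2 (class X11b at
`p = 3`) stays OPEN / CONSTRUCTION-SHAPED. What this file adds: gen 2's K0
(`uniformSchneiderOnLeverLocusAtThree_of_tateSigmaIrrational`: C4 + GZK ⟹ the class-level binder
`UniformSchneiderOnLeverLocusAtThree`) stopped one step short of the census predicate `BSDp W 3`;
the write-up (`HOME/ui/O2-CONJECTURE.md` §7 (b)) said in prose "composed with
`bsdp_of_leverLocus_of_regulatorNonvanishing` it turns the conjecture into BSD(E,3)". Here that
composition is a KERNEL theorem, with ONE binder fewer than the lever's statement of record: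

* `bsdp_three_of_tateSigmaIrrational_of_leverLocus` — for every globally minimal `W` with
  `ClassX11b W 3` (`r_an = 1`, `3 ‖ N`, `E[3]` irreducible; census predicate VERBATIM) on the lever
  locus `LeverLocusAt W 3` (`Ram W 3 ∧ ¬split`): `BSDp W 3`, from C4 and the named facts
  Skinner 2016 Thm. A (`thmA_charIdeal_multiplicative`), Stein–Wuthrich 2013 Thm. 6.1 non-split /
  Jones (`thm61_nonsplitMultiplicative`), Disegni 2020 Thm. 1 (`thm1_padicBSD_rankOne_multiplicative`),
  Gross–Zagier–Kolyvagin (`rank_eq_analyticRank_of_analyticRank_le_one`) and modularity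
  (`nonempty_modularParametrizationData`). The existence of THE §4.2 height datum
  (`exists_isMultCanonical`, binder `hHn` of the lever theorem) is DISCHARGED by the tree theorem
  `exists_isMultCanonical_holds`; the split-side binders (`thm61_splitMultiplicative`,
  `exists_isSplitMultCanonical`) do not occur (the locus is non-split at `3`). The per-pair input
  `RegulatorNonvanishingAt W 3` is supplied UNIFORMLY by C4 (gen 2,
  `regulatorNonvanishingAt_three_of_tateSigmaIrrational`), not by a certificate.
* `bsdp_three_onLeverLocus_of_tateSigmaIrrational` — the same, quantified over the locus (the shape
  the census grid reads: "conjecture + 5 published facts ⟹ BSD₃ on 722 TRUE-OPEN classes of record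
  and every conductor beyond the tables").

Reduction types covered: multiplicative NON-split at `3` with a (ram) prime, `r_an = 1`, `E[3]`
irreducible. Residue NOT covered (unchanged, `O2-CONJECTURE.md` §6): split `3` (needs x11b3's
`RelativeExceptionalLeadingTermAt W 3`), the off-locus class 318828a1, `E[3]` reducible.

References: [Skinner2016PacificMC] Thm. A; [SteinWuthrich2013] Thm. 6.1, §4.2; [Disegni2020] Thm. 1;
[Darmon2004] Thm. 3.22 (GZK); [Schneider1982PadicHeightI] §1; `HOME/ui/O2-CONJECTURE.md` §4, §7, §9.
-/

noncomputable section

open scoped Classical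

namespace Summit.BirchSwinnertonDyer.Uniform.UI.O2

open WeierstrassCurve Literature.NumberTheory.EllipticCurves
open Literature.NumberTheory.EllipticCurves.ModularForms
open Literature.NumberTheory.EllipticCurves.Skinner2016
open Literature.NumberTheory.EllipticCurves.SteinWuthrich2013
open Literature.NumberTheory.EllipticCurves.Disegni2020
open Literature.NumberTheory.EllipticCurves.Rank1Residual
open Summit.BirchSwinnertonDyer.Rank1Residual
open Summit.BirchSwinnertonDyer.Rank1Residual.X11b
open Summit.BirchSwinnertonDyer.Rank1Residual.X11b.ClassClosure

/-- **END-TO-END head (CONDITIONAL on C4 and on the published named facts).** For every globally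
minimal `W` in class X11b at `p = 3` (`ClassX11b W 3`: `r_an = 1 ∧ 3 ≠ 2 ∧ Mult W 3 ∧ Irr W 3`) on the
lever locus (`LeverLocusAt W 3 = Ram W 3 ∧ (split → 5 ≤ 3)`, i.e. (ram) and NON-split at `3`):
`BSDp W 3` — the `3`-part of the BSD formula — from the conjecture `TateSigmaIrrationalAtThree`
(which supplies Schneider's binder uniformly: `regulatorNonvanishingAt_three_of_tateSigmaIrrational`)
and the named facts Skinner 2016 Thm. A (`hA`), Stein–Wuthrich 2013 Thm. 6.1 non-split (`hJ`),
Disegni 2020 Thm. 1 (`hD`), GZK (`hGZK`), modularity (`hpar`); the height-datum existence is the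
tree theorem `exists_isMultCanonical_holds`. Composition of gen 2's K0 with
`X11b.bsdp_of_ram_nonsplit_of_schneider`; no certificate, no conductor bound. Nothing discharged.
[cite: Skinner2016PacificMC, Thm. A] [cite: SteinWuthrich2013, Thm. 6.1, §4.2]
[cite: Disegni2020, Thm. 1] [cite: Darmon2004, Thm. 3.22] [cite: Schneider1982PadicHeightI, §1] -/
theorem bsdp_three_of_tateSigmaIrrational_of_leverLocus (hC : TateSigmaIrrationalAtThree)
    (hA : thmA_charIdeal_multiplicative) (hJ : thm61_nonsplitMultiplicative)
    (hD : thm1_padicBSD_rankOne_multiplicative)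
    (hGZK : rank_eq_analyticRank_of_analyticRank_le_one) (hpar : nonempty_modularParametrizationData)
    (W : WeierstrassCurve ℚ) [W.IsElliptic] [W.IsGloballyMinimal]
    (hX : ClassX11b W 3) (hloc : LeverLocusAt W 3) : BSDp W 3 := by
  have han : W.analyticRank = 1 := hX.1
  have hmult : Mult W 3 := hX.2.2.1
  have hns : ¬ W.HasSplitMultiplicativeReductionAtPrime 3 := fun hsplit ↦ by
    have h5 := hloc.2 hsplit
    omega
  have hr : W.mordellWeilRank = 1 := by rw [(hGZK W han.le).1, han]
  have hReg : RegulatorNonvanishingAt W 3 :=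
    regulatorNonvanishingAt_three_of_tateSigmaIrrational hC W hmult hns hr
  exact bsdp_of_ram_nonsplit_of_schneider W 3 hA hJ exists_isMultCanonical_holds hGZK hpar
    (fun hf ϖ hϖ0 hϖ q hq0 hq1 hqj L hL Dh hDh ↦
      thm1_padicBSD_rankOne_multiplicative.nonsplit hD W 3 hX.2.1 hmult han hf ϖ hϖ0 hϖ hns hq0 hq1
        hqj L hL Dh hDh)
    hX hns hloc.1 hReg.1

/-- **The same, quantified over the locus** (the shape of the census grid row UI-O2: "conjecture +
published facts ⟹ `BSD(E,3)` for every pair of class X11b at `3` on the non-split (ram) locus —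
722 of the 1 684 TRUE-OPEN classes of record and every conductor beyond the tables"). CONDITIONAL;
nothing booked. [cite: Skinner2016PacificMC, Thm. A] [cite: SteinWuthrich2013, Thm. 6.1]
[cite: Disegni2020, Thm. 1] [cite: Darmon2004, Thm. 3.22] -/
theorem bsdp_three_onLeverLocus_of_tateSigmaIrrational (hC : TateSigmaIrrationalAtThree)
    (hA : thmA_charIdeal_multiplicative) (hJ : thm61_nonsplitMultiplicative)
    (hD : thm1_padicBSD_rankOne_multiplicative)
    (hGZK : rank_eq_analyticRank_of_analyticRank_le_one) (hpar : nonempty_modularParametrizationData) :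
    ∀ (W : WeierstrassCurve ℚ) [W.IsElliptic] [W.IsGloballyMinimal],
      ClassX11b W 3 → LeverLocusAt W 3 → BSDp W 3 :=
  fun W _ _ hX hloc ↦ bsdp_three_of_tateSigmaIrrational_of_leverLocus hC hA hJ hD hGZK hpar W hX hloc

end Summit.BirchSwinnertonDyer.Uniform.UI.O2

end
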